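import Summits.QuantumFields.BalabanUV.Beta.GAN24.RelSourceHalf
import Summits.QuantumFields.BalabanUV.Beta.GAN24.CombAffineUnrollProjected

/-!
# `BalabanUV.Beta.GAN24.CombRelSourceHalf` — binder row G-an2-4 ∕ (CONV-C), TRANSFER-III (the (α-0) chain at row D1's literal of record (III′)), the (C)^{ε} ⟸ (C) bridge at
# the comb-chart slot data: **THE RELATIVE SOURCE OF THE COMB-CHART `ε`-MEMBER IS THE `ε`-HALF OF THE FULL COMB-CHART MEMBER's RELATIVE SOURCE**, hypothesis-free —
# MY lineage's (E) file `RelSourceHalf` (gen 72; in the (α-0) END's import closure via `RelSourceHalfCharge` → leaf-02's `RowCChargeForms`) RE-RUN at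
# `(GcombSh Lc ·, SpureCombOf tabs, tabs.M, tabs.vh₂S, tabs.mixFF)` (G-an2-4 CRUX TEAM (2), leaf prover `b2b-balaban-gan24-formalise-leaf-01`, gen 80; the OWNER gan24-p1
# g46's (III′) link table R-gan24p1-g46-2, row «L8b–L9»; no existing file touched)

NOT IN PRINT; OUR BOOKKEEPING ([folklore] composition BY NAME; the statement is MY (E) `relSource_half_eq`'s with `(coDressKBmAt ρ Lc (KInvStep Lc ·), T2RecAt ρ, SpureRecAt ρ, M1At ρ
cΛ, vh₂S, mixFFAt ρ Lc) ↦ (GcombSh Lc ·, T2RecOf … (GcombSh Lc) (SpureCombOf tabs …) tabs.M …, SpureCombOf tabs, tabs.M, tabs.vh₂S, tabs.mixFF)`, root binders `hLc hr` and the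
border class `hB` ↦ the record `tabs : SymTables d Lc`; the UNDRESSED transport `𝒜^K_l = lin4 c₄ (unitK_l (KInvStep Lc l)) Lc` is chart-free and stays; proof token for token
(road-P2's (F1) step with the record's letters; the parities through the two steps by the OWNER's `CombAffineUnrollProjected.sgnK_trK_lin4_unitK_GcombSh` and MY
`Lin4ParityCovariance.sgnK_trK_lin4_unitK_KInvStep`); 0 `def`, 0 cited facts, 0 `def … : Prop`, 0 sorry).  HONEST FRAMING (cell contract, verbatim): «discharging `BetaPertH`
makes Bałaban's UV stability UNCONDITIONAL — a real constructive-QFT result; it is NOT the continuum limit and NOT the Clay problem.»  HONEST DEPENDENCY (verbatim):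
«continuum YM on T⁴ ⇐ BetaPertH ∧ nine spine estimates (0/9 proved); BetaPertH ⇐ (D1) ∧ (D4) ∧ CAP+tail; G-an2-4 gates asym, D1 and NE2/3/4.»

WHAT (every `ε l`; any record `tabs : SymTables d Lc` with off-diagonal border `hBff hBmm`; generic `d`, `Lc ≥ 1` via `[NeZero Lc]`): with `y_l := ½ • (T̃′♮_l + ε • P T̃′♮_l)`,
`G′♮_l := unitK_l (GcombSh Lc l)`, `K♮_l := unitK_l (KInvStep Lc l)`, `c₄ := cE₂·Lc^{2(d+1)}` and the FULL comb-chart member's relative source `b′_l := T̃′♮_{l+1} − 𝒜^K_l T̃′♮_l`: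
**`relSource_comb_half_eq`** — `½ • (b̃′♮_l + ε • P b̃′♮_l) + (𝒜^{G′}_l y_l − 𝒜^K_l y_l) = ½ • (b′_l + ε • P b′_l)` — the LEFT side is the OWNER's T4 ∕ T5 relative source
`b′^{rel,ε}_l` verbatim (`CombT2ShapeEvenEnd` ∕ `CombT2DriftEvenEnd`), the RIGHT side is the `ε`-half of the R-HYB′ relative source on which row (C) is stated.
WHAT THIS IS NOT.  An identity; NOT row (C) ∕ (C)^{ε} at the comb data (the twin of PART 2 `RelSourceHalfCharge` and of leaf-02's `RowCChargeForms` are their own files), NOT one row of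
the S-∕W-slot, NO value; asserts NOTHING about Bałaban's tables; the (III′) campaign is NOT asked (an2 W-4 l.64553) — zero weight; NEVER «G-an2-4 closed» as (CONV-C); NOT D1,
NOT `BetaPertH`, NOT continuum, NOT Clay.  2026-08-25.
-/

noncomputable section

open Finset
open scoped BigOperators
open Literature.MathematicalPhysics.QuantumFieldTheory
open Literature.MathematicalPhysics.QuantumFieldTheory.Balaban1983to89
open Literature.MathematicalPhysics.QuantumFieldTheory.Balaban1983to89.Beta
open ExpKernelCalculus (MKer Decays)
open OneStepResolventKernel (Fib)
open OneStepKernelFamily (KInvStep decays_KInvStep)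
open SecondOrderResponse (W2SymOfK)
open BalabanStepJetsSucc (mmRead)
open BalabanStepW2 (K3OfK M2Of)
open AffineAveraging (box toSite)
open BalabanCompositeJets (LocStencil₂)
open Summit.QuantumFields.BalabanUV.Beta.TameKernelCalculus (trK trK_apply)
open Summit.QuantumFields.BalabanUV.Beta.BorderedHessian (sgnK sgnK_apply)
open Summit.QuantumFields.BalabanUV.Beta.HessKerDressedUnits (unitK unitS decays_unitK)
open Summit.QuantumFields.BalabanUV.Beta.SecondOrderUnits (unitM unitS₂ unitM₂)
open Summit.QuantumFields.BalabanUV.Beta.SpineRooted (T2RecOf)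
open Summit.QuantumFields.BalabanUV.Beta.SymmetrisedStepJets (SymTables)
open Summit.QuantumFields.BalabanUV.Beta.CombChartStepJets (GcombSh decays_GcombSh SpureCombOf locStencil_SpureCombOf)
open Summit.QuantumFields.BalabanUV.Beta.GAN24.CombesThomas (sfStep smStep)
open Summit.QuantumFields.BalabanUV.Beta.GAN24.T2RecursionAffine (lin4)
open Summit.QuantumFields.BalabanUV.Beta.GAN24.BiStencilZeroMode (Tab)
open Summit.QuantumFields.BalabanUV.Beta.GAN24.Lin4Additive (lin4_smul)
open Summit.QuantumFields.BalabanUV.Beta.GAN24.T2UnitSplitLevels (bdd₄_add lin4_add_of_bdd₄)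
open Summit.QuantumFields.BalabanUV.Beta.GAN24.T2RecOfUnitSplit (unitS₂_T2RecOf_succ_eq_lin4_add step_data_of_letters bdd₄_unitS₂_T2RecOf_of_letters)
open Summit.QuantumFields.BalabanUV.Beta.GAN24.AffineUnrollProjected (bdd₄_parity parity_add bdd₄_smul)
open Summit.QuantumFields.BalabanUV.Beta.GAN24.Lin4ParityCovariance (sgnK_trK_lin4_unitK_KInvStep)
open Summit.QuantumFields.BalabanUV.Beta.GAN24.CombAffineUnrollProjected (sgnK_trK_lin4_unitK_GcombSh)
open Summit.QuantumFields.BalabanUV.Beta.GAN24.RelSourceHalf (parity_sub)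

namespace Summit.QuantumFields.BalabanUV.Beta.GAN24.CombRelSourceHalf

variable {d : ℕ}

/-! ## §1 The relative source of the comb-chart `ε`-member -/

section Comb

variable {Lc : ℕ} [NeZero Lc]

/-- NOT IN PRINT; OUR BOOKKEEPING.  **THE RELATIVE SOURCE OF THE COMB-CHART `ε`-MEMBER IS THE `ε`-HALF OF THE FULL COMB-CHART MEMBER's RELATIVE SOURCE** (every `ε l`;
any sym record with off-diagonal border `hBff hBmm`): with `y_l := ½ • (T̃′♮_l + ε • P T̃′♮_l)` and `b′_l := T̃′♮_{l+1} − 𝒜^K_l T̃′♮_l`,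
`½ • (b̃′♮_l + ε • P b̃′♮_l) + (𝒜^{G′}_l y_l − 𝒜^K_l y_l) = ½ • (b′_l + ε • P b′_l)` — the LEFT side is the OWNER's T4 ∕ T5 relative source `b′^{rel,ε}_l` verbatim,
the RIGHT side is the `ε`-half (table-level spelling `c • (X + ε • P X)`, `c = ½`) of the R-HYB′ relative source.  The twin of MY g72 `RelSourceHalf.relSource_half_eq`. -/
theorem relSource_comb_half_eq (tabs : SymTables d Lc) (cE cVH cΛ cE₂ cB : ℝ) (Tc : Fin 4 → Fin 4 → Fin 4 → Fin 4 → ℝ)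
    (hBff : ∀ κ u κ' u' x z (α β : Fin (d + 1)), tabs.vh₂S κ u κ' u' x z (Sum.inl α) (Sum.inl β) = 0)
    (hBmm : ∀ κ u κ' u' x z (μ ν : Fin (d + 1)), tabs.vh₂S κ u κ' u' x z (Sum.inr μ) (Sum.inr ν) = 0) (ε : ℝ) (l : ℕ) :
    ((1 / 2 : ℝ) • ((fun κ u κ' u' => (cE₂ * (Lc : ℝ) ^ (2 * (d + 1))) • mmRead Lc (K3OfK
            (unitK (sfStep Lc l) (smStep d Lc l) (GcombSh (d := d) Lc l)) Lc
            (unitS (sfStep Lc l) (smStep d Lc l) (SpureCombOf tabs cE cVH cΛ l)) (unitM (sfStep Lc l) (smStep d Lc l) (tabs.M l))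
            (W2SymOfK (unitK (sfStep Lc l) (smStep d Lc l) (GcombSh (d := d) Lc l)) Lc
              (unitS (sfStep Lc l) (smStep d Lc l) (SpureCombOf tabs cE cVH cΛ l)) (unitM (sfStep Lc l) (smStep d Lc l) (tabs.M l)) 0
              (unitM₂ (sfStep Lc l) (smStep d Lc l) (M2Of d Lc tabs.mixFF l))) κ u κ' u') + cB • tabs.vh₂S κ u κ' u')
          + ε • fun κ u κ' u' => sgnK (trK ((fun κ u κ' u' => (cE₂ * (Lc : ℝ) ^ (2 * (d + 1))) • mmRead Lc (K3OfK
            (unitK (sfStep Lc l) (smStep d Lc l) (GcombSh (d := d) Lc l)) Lc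
            (unitS (sfStep Lc l) (smStep d Lc l) (SpureCombOf tabs cE cVH cΛ l)) (unitM (sfStep Lc l) (smStep d Lc l) (tabs.M l))
            (W2SymOfK (unitK (sfStep Lc l) (smStep d Lc l) (GcombSh (d := d) Lc l)) Lc
              (unitS (sfStep Lc l) (smStep d Lc l) (SpureCombOf tabs cE cVH cΛ l)) (unitM (sfStep Lc l) (smStep d Lc l) (tabs.M l)) 0
              (unitM₂ (sfStep Lc l) (smStep d Lc l) (M2Of d Lc tabs.mixFF l))) κ u κ' u') + cB • tabs.vh₂S κ u κ' u') κ u κ' u'))))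
        + (lin4 (cE₂ * (Lc : ℝ) ^ (2 * (d + 1))) (unitK (sfStep Lc l) (smStep d Lc l) (GcombSh (d := d) Lc l)) Lc
              ((1 / 2 : ℝ) • (unitS₂ (sfStep Lc l) (smStep d Lc l) (T2RecOf d Lc (GcombSh Lc) (SpureCombOf tabs cE cVH cΛ) tabs.M cE₂ cB Tc tabs.vh₂S tabs.mixFF l)
          + ε • fun κ u κ' u' => sgnK (trK (unitS₂ (sfStep Lc l) (smStep d Lc l) (T2RecOf d Lc (GcombSh Lc) (SpureCombOf tabs cE cVH cΛ) tabs.M cE₂ cB Tc tabs.vh₂S tabs.mixFF l) κ u κ' u'))))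
          - lin4 (cE₂ * (Lc : ℝ) ^ (2 * (d + 1))) (unitK (sfStep Lc l) (smStep d Lc l) (KInvStep (d := d) Lc l)) Lc
              ((1 / 2 : ℝ) • (unitS₂ (sfStep Lc l) (smStep d Lc l) (T2RecOf d Lc (GcombSh Lc) (SpureCombOf tabs cE cVH cΛ) tabs.M cE₂ cB Tc tabs.vh₂S tabs.mixFF l)
          + ε • fun κ u κ' u' => sgnK (trK (unitS₂ (sfStep Lc l) (smStep d Lc l) (T2RecOf d Lc (GcombSh Lc) (SpureCombOf tabs cE cVH cΛ) tabs.M cE₂ cB Tc tabs.vh₂S tabs.mixFF l) κ u κ' u')))))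
      = ((1 / 2 : ℝ) • ((unitS₂ (sfStep Lc (l + 1)) (smStep d Lc (l + 1)) (T2RecOf d Lc (GcombSh Lc) (SpureCombOf tabs cE cVH cΛ) tabs.M cE₂ cB Tc tabs.vh₂S tabs.mixFF (l + 1))
            - lin4 (cE₂ * (Lc : ℝ) ^ (2 * (d + 1))) (unitK (sfStep Lc l) (smStep d Lc l) (KInvStep (d := d) Lc l)) Lc
              (unitS₂ (sfStep Lc l) (smStep d Lc l) (T2RecOf d Lc (GcombSh Lc) (SpureCombOf tabs cE cVH cΛ) tabs.M cE₂ cB Tc tabs.vh₂S tabs.mixFF l)))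
          + ε • fun κ u κ' u' => sgnK (trK ((unitS₂ (sfStep Lc (l + 1)) (smStep d Lc (l + 1)) (T2RecOf d Lc (GcombSh Lc) (SpureCombOf tabs cE cVH cΛ) tabs.M cE₂ cB Tc tabs.vh₂S tabs.mixFF (l + 1))
            - lin4 (cE₂ * (Lc : ℝ) ^ (2 * (d + 1))) (unitK (sfStep Lc l) (smStep d Lc l) (KInvStep (d := d) Lc l)) Lc
              (unitS₂ (sfStep Lc l) (smStep d Lc l) (T2RecOf d Lc (GcombSh Lc) (SpureCombOf tabs cE cVH cΛ) tabs.M cE₂ cB Tc tabs.vh₂S tabs.mixFF l))) κ u κ' u')))) := by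
  have hLc : 1 ≤ Lc := NeZero.one_le
  -- road-P2's (F1) step at the comb letters: `T̃′♮_{l+1} = 𝒜^{G′}_l T̃′♮_l + b̃′♮_l`
  obtain ⟨C, δ, C₀, C₁, hδ, hK, h₀, hW⟩ := step_data_of_letters (GcombSh Lc) (SpureCombOf tabs cE cVH cΛ) tabs.M cE₂ cB Tc hLc
      (decays_GcombSh (d := d) Lc) (locStencil_SpureCombOf tabs cE cVH cΛ) tabs.hM tabs.hB tabs.hmix l
  have hstep := unitS₂_T2RecOf_succ_eq_lin4_add (GcombSh Lc) (SpureCombOf tabs cE cVH cΛ) tabs.M cE₂ cB Tc tabs.vh₂S tabs.mixFF hBff hBmm l hδ hK h₀ hW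
  -- the member is bounded, and so is its parity image
  have hbU := bdd₄_unitS₂_T2RecOf_of_letters (GcombSh Lc) (SpureCombOf tabs cE cVH cΛ) tabs.M cE₂ cB Tc hLc
      (decays_GcombSh (d := d) Lc) (locStencil_SpureCombOf tabs cE cVH cΛ) tabs.hM tabs.hB tabs.hmix l
  have hbP := bdd₄_smul ε (bdd₄_parity hbU)
  obtain ⟨δG, CG, hδG, -, hG⟩ := decays_GcombSh (d := d) Lc l
  obtain ⟨δK, CK, hδK, -, hKK⟩ := decays_KInvStep (d := d) (Lc := Lc) l
  rw [hstep, parity_sub, parity_add, sgnK_trK_lin4_unitK_GcombSh l _ _ _ _ hbU, sgnK_trK_lin4_unitK_KInvStep l _ _ _ _ hbU,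
    lin4_smul, lin4_smul, lin4_add_of_bdd₄ (decays_unitK (sf := sfStep Lc l) (sm := smStep d Lc l) hG) hδG _ _ hbU hbP,
    lin4_add_of_bdd₄ (decays_unitK (sf := sfStep Lc l) (sm := smStep d Lc l) hKK) hδK _ _ hbU hbP, lin4_smul, lin4_smul]
  simp only [smul_add, smul_sub]
  abel

end Comb

end Summit.QuantumFields.BalabanUV.Beta.GAN24.CombRelSourceHalf

end
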